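/-
Lane (xiv-h) «MASS-AWARE CEILING» part 5/5 — MECHANICAL CARVE (rh-split-typer-3 g2, RULING #292 (c)) of zd-neg GEN-18
`HOME/rh-split-zd-neg/g18/tree/MassAwareSamplingCeiling.lean` sha16 60d461fef9600800 (1191 l): source lines 1081–1190 VERBATIM
(cut at the source's `###` section-doc seams); only this header, the imports, the namespace brackets and 3 insert-only one-line docstring(s) (gate `lint.docstring`, repair xivh-a) are added per part.
Nothing here bears on the truth of RH.
-/
import Summits.RiemannHypothesis.RiemannHypothesis.Theorems.Splittings.MassAwareSamplingCeilingD

/-!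
# Splittings — zd-neg GEN-18 «MASS-AWARE CEILING» (the node `MassAwareSamplingL L 2 θ` is FALSE for every `θ ≥ 2/5`), part 5/5
(source sections G18.5): numerics and the verdicts at `δ = 2` (headline `not_massAwareSampling_two_fifths`).
Full provenance, audit notes and the section map are in the source header (zd-neg g18, card `cards/SPLIT-zd-neg.md` GEN-18).

HONEST LABEL: «SPLITTING SEARCH over kernel-typed RH-EQUIVALENCES; a splitting A ∧ B ⟹ RH is CONDITIONAL bookkeeping
unless A and B are both proved; nothing here bears on the truth of RH.»
-/

set_option linter.dupNamespace false

noncomputable section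

open scoped Classical ComplexConjugate
open Set Filter Topology Complex MeasureTheory

namespace Summit.RiemannHypothesis.RiemannHypothesis.Theorems.Splittings.MassAwareSamplingCeiling

open Summit.RiemannHypothesis.RiemannHypothesis.Theorems.Splittings.BombieriTruncMassAware (Phi LocBand MassAwareSampling)

/-! ### G18.5 Numerics and the verdicts at `δ = 2` -/

/-- `Φ(1/4) = 8·sinh(1/2) − 4 ≤ 0.16877` (`exp(1/2)² = e < 2.7182818286`). -/
theorem Phi_quarter_le : Phi (1 / 4) ≤ 0.16877 := by
  unfold Phi
  have hx0 : 0 < Real.exp (1 / 2) := Real.exp_pos _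
  have hsq : Real.exp (1 / 2) ^ 2 = Real.exp 1 := by
    rw [← Real.exp_nat_mul]; norm_num
  have he : Real.exp 1 < 2.7182818286 := Real.exp_one_lt_d9
  have hx : Real.exp (1 / 2) < 1.6487213 := by nlinarith
  have hxlo : 1.6487212 < Real.exp (1 / 2) := by
    have he' : 2.7182818283 < Real.exp 1 := Real.exp_one_gt_d9
    nlinarith
  have hinv : Real.exp (-(1 / 2)) = (Real.exp (1 / 2))⁻¹ := Real.exp_neg _
  have hy : 0.606530 < Real.exp (-(1 / 2)) := by
    rw [hinv, show (0.606530 : ℝ) = (1 / 0.606530)⁻¹ by norm_num]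
    exact inv_strictAnti₀ hx0 (by linarith)
  have hsinh : Real.sinh (1 / 2) = (Real.exp (1 / 2) - Real.exp (-(1 / 2))) / 2 := Real.sinh_eq _
  rw [show (2 : ℝ) * (1 / 4) = 1 / 2 by norm_num, hsinh]
  have : (Real.exp (1 / 2) - Real.exp (-(1 / 2))) / 2 / (1 / 2) = Real.exp (1 / 2) - Real.exp (-(1 / 2)) := by ring
  rw [this]
  linarith

/-- **THE RINGS — CORE.**  The ringed planets at `(p, η, q) = (18/5, 4/5, 16)` (planets `3.6·j` of mass `2000 = 2D`, moons
`3.6j ± (i+1)/20`, `i < 16`, of mass `50 = D/20`; hole `2.0`; `κ ≡ 0`, `w₀ = 0`) and the strip certificate with `L = 5π/9`, `κ₀ = 1/4`,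
`ε = 1/50`, `D = 1000`, `t = 3/10⁴`: cost `≥ 7.2·10⁻⁵ > 7·10⁻⁵ > 1.02·Φ(1/4)/(2000πθ)` for every `θ ≥ 2/5`.  RH-free, ζ-free. -/
theorem rings_core {θ : ℝ} (hθ : 2 / 5 ≤ θ) (m : ℕ) (b : Fin ((2 * m + 1) + (16 * (2 * m + 1) + 16 * (2 * m + 1))) → ℂ)
    (hb' : (∫ u in Icc (-1 : ℝ) 1, ‖synth (1 / 4) (ringLam (18 / 5) (4 / 5) 16 m) b u‖ ^ 2)
      + ∑ k, ‖b k‖ ^ 2 / ringW 2000 50 16 m k ≤ (1 + 1 / 50) * Phi (1 / 4) / (2 * Real.pi * θ * 1000)) : False := by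
  have hπlo : 3.141592 < Real.pi := Real.pi_gt_d6
  have hπhi : Real.pi < 3.141593 := Real.pi_lt_d6
  have hθ0 : 0 < θ := by linarith
  obtain ⟨L, hLdef⟩ : ∃ L : ℝ, L = 5 * Real.pi / 9 := ⟨_, rfl⟩
  have hpL : (18 / 5 : ℝ) * L = 2 * Real.pi := by rw [hLdef]; ring
  have hLlo : 1.745328 ≤ L := by rw [hLdef]; linarith
  have hLhi : L ≤ 1.74533 := by rw [hLdef]; linarith
  have hL1 : 1 ≤ L := by linarith
  have hL2 : L < 2 := by linarith
  have hslo : 0.25467 ≤ 2 - L := by linarith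
  have hshi : 2 - L ≤ 0.254672 := by linarith
  have hwpos : ∀ k, 0 < ringW 2000 50 16 m k := ringW_pos (by norm_num) (by norm_num) 16 m
  have hconv : (∫ u in Icc (-1 : ℝ) 1, ‖synth (1 / 4) (ringLam (18 / 5) (4 / 5) 16 m) b u‖ ^ 2)
      = ∫ u in (-1 : ℝ)..1, ‖synth (1 / 4) (ringLam (18 / 5) (4 / 5) 16 m) b u‖ ^ 2 := by
    rw [MeasureTheory.integral_Icc_eq_integral_Ioc, ← intervalIntegral.integral_of_le (by norm_num)]
  rw [hconv] at hb'
  -- the promised cost is below `7·10⁻⁵`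
  have hΦ := Phi_quarter_le
  have hπθ : 3.141592 * (2 / 5) ≤ Real.pi * θ := mul_le_mul hπlo.le hθ (by norm_num) (by positivity)
  have hcost : (1 + 1 / 50) * Phi (1 / 4) / (2 * Real.pi * θ * 1000) < 7 / 100000 := by
    rw [div_lt_iff₀ (by positivity)]
    nlinarith
  -- the certificate at `t = 3/10000`, the linear gain bound and the ring visibility sum
  have hcert := certificate (κ₀ := 1 / 4) (lam := ringLam (18 / 5) (4 / 5) 16 m) hwpos hL1 hL2 b (3 / 10000)
  have hgain : 2 * (1 / 4) * L * (2 - L) ≤ gain (1 / 4) L := gain_ge (by norm_num) (by linarith) hL2.le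
  have hLs : 1.745328 * 0.25467 ≤ L * (2 - L) := mul_le_mul hLlo hslo (by norm_num) (by linarith)
  have hQ := rings_vis_sum_le m hpL hLlo hLhi
  linarith [hb', hcost, hcert, hgain, hLs, hQ, hslo, hshi]

/-- The rings at `(p, η, q, D) = (18/5, 4/5, 16, 1000)` honour the width-`δ` band on EVERY window of `[−Λ, Λ]`, for every `δ ≥ 2`. -/
theorem rings_bandAll {δ : ℝ} (hδ : 2 ≤ δ) (Λ : ℝ) {m : ℕ} (hm : (Λ + 1) / (18 / 5 : ℝ) < (m : ℝ) + 1) :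
    LocBandAll δ 1000 Λ (ringLam (18 / 5) (4 / 5) 16 m) (ringW 2000 50 16 m) 0 := by
  have h := locBandAll_rings (δ := δ) (p := 18 / 5) (t := 2 / 9) (η := 4 / 5) (D := 1000) (Λ := Λ) (q := 16) (m := m)
    (by norm_num) (by norm_num) (by norm_num) (by norm_num) (by norm_num) (by norm_num) (by linarith) (by norm_num) hm
  norm_num at h
  exact h

/-- **THE RINGS VERDICT FOR THE WHOLE CAPPED FAMILY.** `MassAwareSamplingL L δ θ` (x-wuc G9b/G11c; any cap `L`) is false for every
`δ ≥ 2` and every `θ ≥ 2/5` — the rings honour the band on every window, so the cap is moot. -/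
theorem not_massAwareSamplingL_two_fifths {L δ θ : ℝ} (hδ : 2 ≤ δ) (hθ : 2 / 5 ≤ θ) : ¬ MassAwareSamplingL L δ θ := by
  intro hS
  obtain ⟨Λ, hΛ0, -, hmain⟩ := hS (1 / 50) (by norm_num) (1 / 4) (by norm_num) (by norm_num) 1000 (by norm_num)
  obtain ⟨m, hm⟩ : ∃ m : ℕ, (Λ + 1) / (18 / 5 : ℝ) < (m : ℝ) + 1 := ⟨_, Nat.lt_floor_add_one _⟩
  have hband : LocBandL L δ 1000 Λ (ringLam (18 / 5) (4 / 5) 16 m) (ringW 2000 50 16 m) 0 :=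
    fun a b ha hab hb _ ↦ rings_bandAll hδ Λ hm a b ha hab hb
  have hwpos : ∀ k, 0 < ringW 2000 50 16 m k := ringW_pos (by norm_num) (by norm_num) 16 m
  obtain ⟨b, hb⟩ := hmain _ (ringLam (18 / 5) (4 / 5) 16 m) (ringW 2000 50 16 m) (fun _ ↦ 0) 0 le_rfl (by positivity)
    hwpos (fun _ ↦ ⟨le_rfl, by norm_num⟩) hband
  simp only [zero_mul, Real.cosh_zero, Complex.ofReal_one, mul_one] at hb
  exact rings_core hθ m b hb

/-- **THE RINGS VERDICT, cap-4 node** (`MassAwareSampling` IS the tree's `…BombieriTruncMassAware.MassAwareSampling`). -/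
theorem not_massAwareSampling_two_fifths {δ θ : ℝ} (hδ : 2 ≤ δ) (hθ : 2 / 5 ≤ θ) : ¬ MassAwareSampling δ θ :=
  fun h ↦ not_massAwareSamplingL_two_fifths (L := 4) hδ hθ (massAwareSampling_iff_massAwareSamplingL_four.mp h)

/-- **THE RINGS VERDICT, all-windows / spectral-cap form** (every `Λ₀`). -/
theorem not_massAwareSamplingAllCap_two_fifths {Λ₀ δ θ : ℝ} (hδ : 2 ≤ δ) (hθ : 2 / 5 ≤ θ) :
    ¬ MassAwareSamplingAllCap Λ₀ δ θ := by
  intro hS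
  obtain ⟨Λ, hΛ0, -, hmain⟩ := hS (1 / 50) (by norm_num) (1 / 4) (by norm_num) (by norm_num) 1000 (by norm_num)
  obtain ⟨m, hm⟩ : ∃ m : ℕ, (Λ + 1) / (18 / 5 : ℝ) < (m : ℝ) + 1 := ⟨_, Nat.lt_floor_add_one _⟩
  have hband : LocBandAll δ 1000 Λ (ringLam (18 / 5) (4 / 5) 16 m) (ringW 2000 50 16 m) 0 := rings_bandAll hδ Λ hm
  have hwpos : ∀ k, 0 < ringW 2000 50 16 m k := ringW_pos (by norm_num) (by norm_num) 16 m
  obtain ⟨b, hb⟩ := hmain _ (ringLam (18 / 5) (4 / 5) 16 m) (ringW 2000 50 16 m) (fun _ ↦ 0) 0 le_rfl (by positivity)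
    hwpos (fun _ ↦ ⟨le_rfl, by norm_num⟩) hband
  simp only [zero_mul, Real.cosh_zero, Complex.ofReal_one, mul_one] at hb
  exact rings_core hθ m b hb

/-- ★_400's node: `MassAwareSamplingL 400 2 θ` is false for every `θ ≥ 2/5` (the row needs it at some `θ ≥ 0.056`). -/
theorem not_massAwareSamplingL_400_two {θ : ℝ} (hθ : 2 / 5 ≤ θ) : ¬ MassAwareSamplingL 400 2 θ :=
  not_massAwareSamplingL_two_fifths le_rfl hθ

/-- ★_400's node at the corner: `¬ MassAwareSamplingL 400 2 (2/5)`. Nothing here bears on the truth of RH. -/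
theorem not_massAwareSamplingL_400_two_at : ¬ MassAwareSamplingL 400 2 (2 / 5) :=
  not_massAwareSamplingL_two_fifths le_rfl le_rfl

/-- The all-windows capped node `MassAwareSamplingAllCap 100 2 θ` is false for every `θ ≥ 2/5`. Nothing here bears on the truth of RH. -/
theorem not_massAwareSamplingAllCap_100_two {θ : ℝ} (hθ : 2 / 5 ≤ θ) : ¬ MassAwareSamplingAllCap 100 2 θ :=
  not_massAwareSamplingAllCap_two_fifths le_rfl hθ

/-- The TREE node `MassAwareSampling 2 θ` (`= MassAwareSamplingL 4 2 θ`) is false for every `θ ≥ 2/5`. Nothing here bears on the truth of RH. -/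
theorem not_massAwareSampling_two {θ : ℝ} (hθ : 2 / 5 ≤ θ) : ¬ MassAwareSampling 2 θ :=
  not_massAwareSampling_two_fifths le_rfl hθ


end Summit.RiemannHypothesis.RiemannHypothesis.Theorems.Splittings.MassAwareSamplingCeiling
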